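import Summits.HodgeConjecture.HodgeConjecture.Theorems.VHCAbelianSchemesRoadPencilThroughDefs
import Summits.HodgeConjecture.HodgeConjecture.Theorems.VHCAbelianSchemesRoadServedFibreAnchors
import HarnessLib

/-!
# Road b02 (`VHCAbelianSchemesRoad`) — PENCIL-LEVEL NON-VACUITY OF THE SERVED-FIBRE PARTITION FROM AN EXCEPTIONAL PENCIL THROUGH AN ANCHOR

research route conditional on HC_CM; not a corollary; Q11.4-sentence-2 already refuted in dim ≥ 3.

Door-, degree- and anchor-generic, FACT-FREE; companion of `VHCAbelianSchemesRoadPencilThroughDefs` and of PART AA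
(`VHCAbelianSchemesRoadServedFibre{Defs,,Anchors}`). The tribunal's «no cosmetic split» reading of a through-anchor / residual cut at
PENCIL level asks that the served-fibre predicate `HasServedFibre n p 𝔄 𝔖` be satisfiable INSIDE the cell's binders AND its regime-2
hypotheses (`W` algebraic at one fibre, not algebraic-Lefschetz at every fibre) — i.e. that the hypothesis of `under_not_iff_of_forall_not`
FAILS. PART AA's anchors file gets this from the constant pencil when the served class is NOT Lefschetz at the anchor; at Markman's
secant-quotient anchors the served Weil class IS Lefschetz (every Hodge class of `(X × X̂)/Ḡ`, `X` a generic p.p. abelian threefold, is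
a polynomial in divisor classes), so the witness must be a pencil through the anchor that is exceptional ELSEWHERE. This file proves:

* §1 `exists_servedPencil_of_anchor_of_mem_exceptionalPencilClassesThrough` — anchor data `(𝔄, 𝔖)` transportable along isomorphisms, an
  anchor `(X, θ)` and a served class `w ∈ 𝔖 X θ` that is ALGEBRAIC on `X` and lies in `exceptionalPencilClassesThrough n p X θ` give a
  pencil `f : 𝒳 ⟶ S` with `W` satisfying EVERY binder of the cell `(n, p)` and the regime-2 hypotheses (algebraic at the anchor fibre, not
  Lefschetz everywhere) together WITH `HasServedFibre n p 𝔄 𝔖 f W` (served at the anchor fibre by the global `Θ` of the pencil); the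
  `¬ ∀`-form `not_forall_not_hasServedFibre_of_anchor_of_mem_exceptionalPencilClassesThrough` (the hypothesis of `under_not_iff_of_forall_not`
  fails), and the `(6, 3)` specialisations.
* §2 `mem_exceptionalPencilClassesThrough_of_not_mem_divisorClassesSpan` — the constant pencil: for `X ≅` an abelian `n`-fold, `θ`
  rational `(1,1)`, `w` rational `(p,p)` and `w ∉ Dᵖ(X) ⊗ ℂ`, `w ∈ exceptionalPencilClassesThrough n p X θ` (PART Z-c's `X × 𝔸¹`,
  `Θ := pr₁^*θ`, `W := pr₁^*w`, exceptional at the origin) — so PART AA's `exists_servedPencil_of_anchor` is the special case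
  (§1 applied to §2; not restated).
* §3 `exceptionalPencilClassesThrough_map_of_iso` — the set is transported by isomorphisms `X ≅ X'` (compose the chart).

What is NOT claimed: that any particular anchor lies on an exceptional pencil (for the Markman instance this is a named hypothesis of
`VHCAbelianSchemesRoadSecantAnchorInhabited`); any carrier, residual, cell, K-SR♭∃, VHC, `HC_AV`, HC; `HC_CM` occurs nowhere.
References: [cite: Bloch1972Semiregularity, Remark (7.5)] [cite: vanGeemen1994HodgeAV, §2.4, Thm. 4.11 and 5.3–5.5]
[cite: Hartshorne1977, II.3 (p. 89) and II Ex. 4.9] [cite: Markman2025SecantWeil, Thm. 1.4.1] [cite: VoisinHodgeI2002, Thm. 7.10 and §7.1.2].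
-/

noncomputable section

open CategoryTheory CategoryTheory.Limits AlgebraicGeometry Topology MonoidalCategory CartesianMonoidalCategory

-- the cell's namespace repeats the summit name (`Summit.HodgeConjecture.HodgeConjecture…`), as in every `Ring2*` file
set_option linter.dupNamespace false

namespace Summit.HodgeConjecture.HodgeConjecture.Ring2.SemiregularRepresentatives

open Literature.AlgebraicGeometry Literature.AlgebraicGeometry.Motives
open Literature.AlgebraicGeometry.HodgeTheory
open Literature.AlgebraicTopology.SingularHomology
open Literature.Barriers.HodgeConjecture (divisorClassesSpan)
open Summit.Ventures.HSemireg (ObjClass)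

variable {n p : ℕ}
variable {𝔄 : ∀ X : SchemeOver ℂ, complexBetti X 2 → Prop} {𝔖 : ∀ (X : SchemeOver ℂ), complexBetti X 2 → Set (complexBetti X (2 * p))}

/-! ## §1 A served class on an exceptional cell-shaped pencil through an anchor gives a served pencil in regime 2 -/

/-- **PENCIL-LEVEL NON-VACUITY FROM AN EXCEPTIONAL PENCIL THROUGH AN ANCHOR** (door-, degree-, anchor-generic; fact-free). Let the anchor
data be transportable along isomorphisms (`htr`), `(X, θ)` an anchor (`𝔄 X θ`), `w ∈ 𝔖 X θ` a served class that is ALGEBRAIC on `X`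
and continued by a somewhere-exceptional class along a cell-shaped pencil through `(X, θ)` (`w ∈ exceptionalPencilClassesThrough n p X θ`).
Then there are a one-parameter family `f : 𝒳 ⟶ S` satisfying EVERY binder of the cell `(n, p)` of K-SR♭∃, a global class `W`
satisfying the regime-2 hypotheses (fibrewise rational `(p,p)`; algebraic at `s₀`, the anchor fibre; NOT algebraic-Lefschetz on every
fibre) AND a served fibre (`HasServedFibre n p 𝔄 𝔖 f W`: the anchor fibre `𝒳_{s₀} ≅ X`, polarised by the pencil's global `Θ` with
`Θ|_{s₀} = θ` transported, serving `W|_{s₀} = w` transported). [cite: vanGeemen1994HodgeAV, Thm. 4.11 and 5.5]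
[cite: Bloch1972Semiregularity, Remark (7.5)] [cite: VoisinHodgeI2002, §7.1.2] -/
theorem exists_servedPencil_of_anchor_of_mem_exceptionalPencilClassesThrough
    (htr : ∀ ⦃X X' : SchemeOver ℂ⦄ (e : X ≅ X') (θ : complexBetti X 2) (w : complexBetti X (2 * p)), 𝔄 X θ → w ∈ 𝔖 X θ →
      𝔄 X' (complexBetti.map e.inv 2 θ) ∧ complexBetti.map e.inv (2 * p) w ∈ 𝔖 X' (complexBetti.map e.inv 2 θ))
    (X : SchemeOver ℂ) (θ : complexBetti X 2) (hanc : 𝔄 X θ)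
    (w : complexBetti X (2 * p)) (hw𝔖 : w ∈ 𝔖 X θ) (hwalg : w ∈ algebraicClasses X p)
    (hpen : w ∈ exceptionalPencilClassesThrough n p X θ) :
    ∃ (𝒳 S : SchemeOver ℂ) (f : 𝒳 ⟶ S) (W : complexBetti 𝒳 (2 * p)) (s₀ : ComplexPoints S),
      IsSmoothProjectiveFamily f n ∧ IsQuasiProjectiveOver 𝒳 ∧ IrreducibleSpace S.left ∧ IsAffine S.left ∧
      AlgebraicGeometry.Smooth S.hom ∧ topologicalKrullDim S.left = 1 ∧
      (∀ s : ComplexPoints S, ∃ A' : AbelianVariety ℂ, A'.dim = n ∧ Nonempty (A'.X ≅ fiberOver f s)) ∧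
      (∃ e : S ⟶ 𝒳, e ≫ f = 𝟙 S) ∧
      (∀ s : ComplexPoints S, IsRationalClass (complexBetti.map (fiberι f s) (2 * p) W) ∧
        IsOfHodgeType n (fiberOver f s) (2 * p) p p (complexBetti.map (fiberι f s) (2 * p) W)) ∧
      complexBetti.map (fiberι f s₀) (2 * p) W ∈ algebraicClasses (fiberOver f s₀) p ∧
      (¬ ∀ s : ComplexPoints S,
        complexBetti.map (fiberι f s) (2 * p) W ∈ algebraicClasses (fiberOver f s) p ∧
        complexBetti.map (fiberι f s) (2 * p) W ∈ divisorClassesSpan (fiberOver f s) n p) ∧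
      HasServedFibre n p 𝔄 𝔖 f W := by
  obtain ⟨𝒳, S, f, sₐ, e, Θ, W, hf, h𝒳, hirr, haff, hsm, hdim, hab, hsec, hΘQ, hΘH, hW, hΘ, hWa, hexc⟩ := hpen
  refine ⟨𝒳, S, f, W, sₐ, hf, h𝒳, hirr, haff, hsm, hdim, hab, hsec, hW, ?_, hexc, ?_⟩
  · rw [hWa]
    exact (mem_algebraicClasses_map_iff_of_iso e.symm).2 hwalg
  · refine ⟨sₐ, Θ, hΘQ, hΘH, ?_, ?_⟩
    · rw [hΘ]
      exact (htr e θ w hanc hw𝔖).1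
    · rw [hΘ, hWa]
      exact (htr e θ w hanc hw𝔖).2

/-- **Hence the served-pencil predicate is satisfiable together with the cell's binders and regime 2**: with ONE such anchor it is NOT
the case that every smooth projective family of relative dimension `n` with abelian fibres and a somewhere-exceptional `W` has NO served
fibre — the hypothesis of `under_not_iff_of_forall_not (HasServedFibre n p 𝔄 𝔖)` fails, the residual `…Under … (¬ HasServedFibre …)`
genuinely EXCLUDES a pencil of the cell, and the through-anchor piece genuinely asserts a datum. [cite: Bloch1972Semiregularity, Remark (7.5)]
[cite: vanGeemen1994HodgeAV, Thm. 4.11] -/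
theorem not_forall_not_hasServedFibre_of_anchor_of_mem_exceptionalPencilClassesThrough
    (htr : ∀ ⦃X X' : SchemeOver ℂ⦄ (e : X ≅ X') (θ : complexBetti X 2) (w : complexBetti X (2 * p)), 𝔄 X θ → w ∈ 𝔖 X θ →
      𝔄 X' (complexBetti.map e.inv 2 θ) ∧ complexBetti.map e.inv (2 * p) w ∈ 𝔖 X' (complexBetti.map e.inv 2 θ))
    (X : SchemeOver ℂ) (θ : complexBetti X 2) (hanc : 𝔄 X θ)
    (w : complexBetti X (2 * p)) (hw𝔖 : w ∈ 𝔖 X θ) (hwalg : w ∈ algebraicClasses X p)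
    (hpen : w ∈ exceptionalPencilClassesThrough n p X θ) :
    ¬ ∀ ⦃𝒳 S : SchemeOver ℂ⦄ (f : 𝒳 ⟶ S) (W : complexBetti 𝒳 (2 * p)), IsSmoothProjectiveFamily f n →
      (∀ s : ComplexPoints S, ∃ A' : AbelianVariety ℂ, A'.dim = n ∧ Nonempty (A'.X ≅ fiberOver f s)) →
      (¬ ∀ s : ComplexPoints S,
        complexBetti.map (fiberι f s) (2 * p) W ∈ algebraicClasses (fiberOver f s) p ∧
        complexBetti.map (fiberι f s) (2 * p) W ∈ divisorClassesSpan (fiberOver f s) n p) →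
      ¬ HasServedFibre n p 𝔄 𝔖 f W := by
  intro hnone
  obtain ⟨𝒳, S, f, W, s₀, hf, -, -, -, -, -, hab, -, -, -, hexc, hserved⟩ :=
    exists_servedPencil_of_anchor_of_mem_exceptionalPencilClassesThrough htr X θ hanc w hw𝔖 hwalg hpen
  exact hnone f W hf hab hexc hserved

/-- **The same with the FULL binder list in the negated universal statement** (base affine smooth irreducible of Krull dimension one, a
section, fibrewise rational `(p,p)`, algebraic at some fibre): the residual of the cut excludes a pencil satisfying every hypothesis
of the cell `LefAtExceptionalRegimeAt _ n p` in regime 2. [cite: Bloch1972Semiregularity, Remark (7.5)] [cite: vanGeemen1994HodgeAV, Thm. 4.11] -/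
theorem not_forall_cell_not_hasServedFibre_of_anchor_of_mem_exceptionalPencilClassesThrough
    (htr : ∀ ⦃X X' : SchemeOver ℂ⦄ (e : X ≅ X') (θ : complexBetti X 2) (w : complexBetti X (2 * p)), 𝔄 X θ → w ∈ 𝔖 X θ →
      𝔄 X' (complexBetti.map e.inv 2 θ) ∧ complexBetti.map e.inv (2 * p) w ∈ 𝔖 X' (complexBetti.map e.inv 2 θ))
    (X : SchemeOver ℂ) (θ : complexBetti X 2) (hanc : 𝔄 X θ)
    (w : complexBetti X (2 * p)) (hw𝔖 : w ∈ 𝔖 X θ) (hwalg : w ∈ algebraicClasses X p)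
    (hpen : w ∈ exceptionalPencilClassesThrough n p X θ) :
    ¬ ∀ ⦃𝒳 S : SchemeOver ℂ⦄ (f : 𝒳 ⟶ S), IsSmoothProjectiveFamily f n → IsQuasiProjectiveOver 𝒳 →
      IrreducibleSpace S.left → IsAffine S.left → AlgebraicGeometry.Smooth S.hom → topologicalKrullDim S.left = 1 →
      (∀ s : ComplexPoints S, ∃ A' : AbelianVariety ℂ, A'.dim = n ∧ Nonempty (A'.X ≅ fiberOver f s)) →
      (∃ e : S ⟶ 𝒳, e ≫ f = 𝟙 S) →
      ∀ (W : complexBetti 𝒳 (2 * p)),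
        (∀ s : ComplexPoints S, IsRationalClass (complexBetti.map (fiberι f s) (2 * p) W) ∧
          IsOfHodgeType n (fiberOver f s) (2 * p) p p (complexBetti.map (fiberι f s) (2 * p) W)) →
        ∀ s₀ : ComplexPoints S,
          complexBetti.map (fiberι f s₀) (2 * p) W ∈ algebraicClasses (fiberOver f s₀) p →
          (¬ ∀ s : ComplexPoints S,
            complexBetti.map (fiberι f s) (2 * p) W ∈ algebraicClasses (fiberOver f s) p ∧
            complexBetti.map (fiberι f s) (2 * p) W ∈ divisorClassesSpan (fiberOver f s) n p) →
          ¬ HasServedFibre n p 𝔄 𝔖 f W := by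
  intro hnone
  obtain ⟨𝒳, S, f, W, s₀, hf, h𝒳, hirr, haff, hsm, hdim, hab, hsec, hW, halg, hexc, hserved⟩ :=
    exists_servedPencil_of_anchor_of_mem_exceptionalPencilClassesThrough htr X θ hanc w hw𝔖 hwalg hpen
  exact hnone f hf h𝒳 hirr haff hsm hdim hab hsec W hW s₀ halg hexc hserved

/-- **The `(6, 3)` form** (abelian sixfold pencils, codimension `3` — the rung of crux stmt-HodgeConjecture-19787): one anchor `(X, θ)`
with a served algebraic class on an exceptional cell-shaped sixfold pencil through it makes the `(6,3)` served-fibre predicate satisfiable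
inside the cell. [cite: vanGeemen1994HodgeAV, Thm. 4.11] [cite: Markman2025SecantWeil, Thm. 1.4.1] -/
theorem not_forall_not_hasServedFibre_63_of_anchor_of_mem_exceptionalPencilClassesThrough
    {𝔄 : ∀ X : SchemeOver ℂ, complexBetti X 2 → Prop} {𝔖 : ∀ X : SchemeOver ℂ, complexBetti X 2 → Set (complexBetti X (2 * 3))}
    (htr : ∀ ⦃X X' : SchemeOver ℂ⦄ (e : X ≅ X') (θ : complexBetti X 2) (w : complexBetti X (2 * 3)), 𝔄 X θ → w ∈ 𝔖 X θ →
      𝔄 X' (complexBetti.map e.inv 2 θ) ∧ complexBetti.map e.inv (2 * 3) w ∈ 𝔖 X' (complexBetti.map e.inv 2 θ))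
    (X : SchemeOver ℂ) (θ : complexBetti X 2) (hanc : 𝔄 X θ)
    (w : complexBetti X (2 * 3)) (hw𝔖 : w ∈ 𝔖 X θ) (hwalg : w ∈ algebraicClasses X 3)
    (hpen : w ∈ exceptionalPencilClassesThrough 6 3 X θ) :
    ¬ ∀ ⦃𝒳 S : SchemeOver ℂ⦄ (f : 𝒳 ⟶ S) (W : complexBetti 𝒳 (2 * 3)), IsSmoothProjectiveFamily f 6 →
      (∀ s : ComplexPoints S, ∃ A' : AbelianVariety ℂ, A'.dim = 6 ∧ Nonempty (A'.X ≅ fiberOver f s)) →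
      (¬ ∀ s : ComplexPoints S,
        complexBetti.map (fiberι f s) (2 * 3) W ∈ algebraicClasses (fiberOver f s) 3 ∧
        complexBetti.map (fiberι f s) (2 * 3) W ∈ divisorClassesSpan (fiberOver f s) 6 3) →
      ¬ HasServedFibre 6 3 𝔄 𝔖 f W :=
  not_forall_not_hasServedFibre_of_anchor_of_mem_exceptionalPencilClassesThrough htr X θ hanc w hw𝔖 hwalg hpen

/-! ## §2 The constant pencil: `w ∉ Dᵖ(X) ⊗ ℂ` at the anchor implies membership (PART AA's criterion is the special case) -/

/-- **A class off `Dᵖ ⊗ ℂ` on a variety isomorphic to an abelian `n`-fold lies on an exceptional cell-shaped pencil: the CONSTANT pencil.**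
For `X ≅` an abelian `n`-fold, `θ` rational of type `(1,1)`, `w` rational of type `(p,p)` with `w ∉ divisorClassesSpan X n p`:
`w ∈ exceptionalPencilClassesThrough n p X θ`, witnessed by `pr₂ : X × 𝔸¹ ⟶ 𝔸¹` (PART Z-c: every binder of the cell), the origin `sₐ`
with the slice isomorphism `X ≅ (X × 𝔸¹)_{sₐ}`, `Θ := pr₁^*θ`, `W := pr₁^*w` (exceptional at the origin itself).
[cite: Hartshorne1977, II.3 (p. 89) and II Ex. 4.9] [cite: vanGeemen1994HodgeAV, §2.4] -/
theorem mem_exceptionalPencilClassesThrough_of_not_mem_divisorClassesSpan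
    (X : SchemeOver ℂ) (hXab : ∃ A : AbelianVariety ℂ, A.dim = n ∧ Nonempty (A.X ≅ X))
    (θ : complexBetti X 2) (hθQ : IsRationalClass θ) (hθH : IsOfHodgeType n X 2 1 1 θ)
    (w : complexBetti X (2 * p)) (hwQ : IsRationalClass w) (hwH : IsOfHodgeType n X (2 * p) p p w)
    (hwD : w ∉ divisorClassesSpan X n p) :
    w ∈ exceptionalPencilClassesThrough n p X θ := by
  obtain ⟨A, hA, ⟨eA⟩⟩ := hXab
  have hAX : IsSmoothProjective n A.X := hA ▸ AbelianVariety.isSmoothProjective_holds (A := A)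
  have hX : IsSmoothProjective n X := hAX.of_iso eA
  haveI : IrreducibleSpace (specOver ℂ (MvPolynomial (Fin 1) ℂ)).left := irreducibleSpace_affineLine_left
  haveI : IsAffine (specOver ℂ (MvPolynomial (Fin 1) ℂ)).left := isAffine_affineLine_left
  obtain ⟨s₀⟩ := nonempty_complexPoints_affineLine
  have hf : IsSmoothProjectiveFamily (snd X (specOver ℂ (MvPolynomial (Fin 1) ℂ))) n :=
    isSmoothProjectiveFamily_snd hX _
  have h𝒳 : IsQuasiProjectiveOver (X ⊗ specOver ℂ (MvPolynomial (Fin 1) ℂ)) :=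
    isQuasiProjectiveOver_tensor_of_isProjectiveOver hX.isProjectiveOver isQuasiProjectiveOver_affineLine
  have habel : ∀ s : ComplexPoints (specOver ℂ (MvPolynomial (Fin 1) ℂ)),
      ∃ A' : AbelianVariety ℂ, A'.dim = n ∧ Nonempty (A'.X ≅ fiberOver (snd X (specOver ℂ (MvPolynomial (Fin 1) ℂ))) s) :=
    fun s ↦ ⟨A, hA, ⟨eA ≪≫ sliceFiberIso X s⟩⟩
  have hres := fun s : ComplexPoints (specOver ℂ (MvPolynomial (Fin 1) ℂ)) ↦ map_fiberι_map_fst_eq s (2 * p) w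
  have hresθ := fun s : ComplexPoints (specOver ℂ (MvPolynomial (Fin 1) ℂ)) ↦ map_fiberι_map_fst_eq s 2 θ
  have hexc : ¬ ∀ s : ComplexPoints (specOver ℂ (MvPolynomial (Fin 1) ℂ)),
      complexBetti.map (fiberι (snd X _) s) (2 * p) (complexBetti.map (fst X _) (2 * p) w) ∈
          algebraicClasses (fiberOver (snd X _) s) p ∧
        complexBetti.map (fiberι (snd X _) s) (2 * p) (complexBetti.map (fst X _) (2 * p) w) ∈
          divisorClassesSpan (fiberOver (snd X _) s) n p := by
    intro hall
    obtain ⟨-, hD⟩ := hall s₀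
    apply hwD
    have hback := map_mem_divisorClassesSpan hX (hf.isSmoothProjective s₀) (sliceFiberIso X s₀).hom hD
    rwa [hres s₀, (sliceFiberIso X s₀).complexBetti_map_hom_map_inv] at hback
  refine ⟨_, _, snd X (specOver ℂ (MvPolynomial (Fin 1) ℂ)), s₀, sliceFiberIso X s₀, complexBetti.map (fst X _) 2 θ,
    complexBetti.map (fst X _) (2 * p) w, hf, h𝒳, irreducibleSpace_affineLine_left, isAffine_affineLine_left,
    smooth_affineLine_hom, topologicalKrullDim_affineLine_left, habel, exists_section_snd A eA _, fun s ↦ ?_, fun s ↦ ?_,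
    fun s ↦ ?_, hresθ s₀, hres s₀, hexc⟩
  · rw [hresθ s]
    exact (isRationalClass_map_iff_of_iso (sliceFiberIso X s).symm).2 hθQ
  · rw [hresθ s]
    exact (isOfHodgeType_map_iff_of_iso (sliceFiberIso X s).symm).2 hθH
  · rw [hres s]
    exact ⟨(isRationalClass_map_iff_of_iso (sliceFiberIso X s).symm).2 hwQ,
      (isOfHodgeType_map_iff_of_iso (sliceFiberIso X s).symm).2 hwH⟩

-- PART AA's `exists_servedPencil_of_anchor` (`VHCAbelianSchemesRoadServedFibreAnchors`) is §1 applied to §2 — not restated here (same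
-- statement; cite that name).

/-! ## §3 Transport of the set along isomorphisms -/

/-- **`exceptionalPencilClassesThrough` is transported by isomorphisms**: for `e : X ≅ X'`, if `w ∈ exceptionalPencilClassesThrough n p X θ`
then `(e⁻¹)^*w ∈ exceptionalPencilClassesThrough n p X' ((e⁻¹)^*θ)` (same pencil, chart `X' ≅ X ≅ 𝒳_{sₐ}`). [folklore]
[cite: vanGeemen1994HodgeAV, 5.5] -/
theorem exceptionalPencilClassesThrough_map_of_iso {X X' : SchemeOver ℂ} (e : X ≅ X') (θ : complexBetti X 2)
    {w : complexBetti X (2 * p)} (hw : w ∈ exceptionalPencilClassesThrough n p X θ) :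
    complexBetti.map e.inv (2 * p) w ∈ exceptionalPencilClassesThrough n p X' (complexBetti.map e.inv 2 θ) := by
  obtain ⟨𝒳, S, f, sₐ, e₁, Θ, W, hf, h𝒳, hirr, haff, hsm, hdim, hab, hsec, hΘQ, hΘH, hW, hΘ, hWa, hexc⟩ := hw
  refine ⟨𝒳, S, f, sₐ, e.symm ≪≫ e₁, Θ, W, hf, h𝒳, hirr, haff, hsm, hdim, hab, hsec, hΘQ, hΘH, hW, ?_, ?_, hexc⟩
  · rw [hΘ, Iso.trans_inv, Iso.symm_inv, complexBetti.map_comp, CategoryTheory.comp_apply, e.complexBetti_map_hom_map_inv]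
  · rw [hWa, Iso.trans_inv, Iso.symm_inv, complexBetti.map_comp, CategoryTheory.comp_apply, e.complexBetti_map_hom_map_inv]

end Summit.HodgeConjecture.HodgeConjecture.Ring2.SemiregularRepresentatives

end
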